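import Mathlib
import Summits.FinalStateConjecture.FinalStateConjecture.Theorems.PhotonSphereChannelsBlindnessWaveCalculus

/-!
# Route StarvedNecks — crux `NecksCertify`, line `bargmann-small-late-exterior`: rung R2

Stub `stub_characteristicCalculus` (statement `CharacteristicCalculus`): the characteristic
(d'Alembert) calculus of `C²` fields on `ℝ²` — pure analysis, no PDE, no region.  For
`ψ, χ : ℝ → ℝ → ℝ` with `uncurry ψ, uncurry χ ∈ C²`, `φ = ψ − χ`, `w = φ_t + φ_r`, `z = φ_t − φ_r`,
`D = φ_tt − φ_rr` (in the route statements' `deriv` / `iteratedDeriv 2` slice form): the four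
fields are continuous; the TRANSPORT IDENTITIES `w(t,r) = w(t−a, r+a) + ∫₀ᵃ D(t−s, r+s) ds`
(incoming ray), `φ(t,r) = φ(t−a, r−a) + ∫₀ᵃ w(t−s, r−s) ds` and
`z(t,r) = z(t−a, r−a) + ∫₀ᵃ D(t−s, r−s) ds` (outgoing ray) hold for every real `a` — the
fundamental theorem of calculus along the affine
characteristics `s ↦ (t − s, r ± s)` plus Schwarz `φ_tr = φ_rt` (`ContDiffAt.isSymmSndFDerivAt`),
which turns `d/ds w(t−s, r+s) = D²φ(−1,1)(1,1)` into `−(φ_tt − φ_rr)`; and the DATA FACTS: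
matching slab data (`χ = ψ`, `χ_t = ψ_t` at `t = T`, `r ≥ R₀`) give `φ = w = z = 0` there, matching
cylinder trace (`χ = ψ` at `r = R₀`, `t ≥ T`) gives `φ = 0`, `z = −w` there (a function vanishing
on a closed half-line has zero derivative at every point of it, `uniqueDiffWithinAt_Ici`).

The statement is registered in `let`-free form (the defining equations of `φ, w, z, D` are
hypotheses); `characteristicCalculus_let` is the skeleton's original `let` layout.  The slice
dictionary (`deriv_time_eq`, `iteratedDeriv_time_eq`, `fderiv_fderiv_apply`, …) comes from
`Theorems/PhotonSphereChannelsBlindnessWaveCalculus`.  Mathlib only otherwise; no named facts,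
no definitions.
-/

noncomputable section

namespace Summit.FinalStateConjecture.FinalStateConjecture.Theorems.NecksCertifyBargmann.Calculus

open Filter Topology MeasureTheory Set Function
open scoped Topology
open Summit.FinalStateConjecture.FinalStateConjecture.Theorems.Blindness

section Rays

variable {φ : ℝ → ℝ → ℝ}

/-- The incoming ray `σ ↦ (t − σ, r + σ)` has velocity `(−1, 1)`. -/
theorem hasDerivAt_inRay (t r s : ℝ) :
    HasDerivAt (fun σ : ℝ => (t - σ, r + σ)) ((-1 : ℝ), (1 : ℝ)) s :=
  ((hasDerivAt_id' s).const_sub t).prodMk ((hasDerivAt_id' s).const_add r)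

/-- The outgoing ray (run backwards) `σ ↦ (t − σ, r − σ)` has velocity `(−1, −1)`. -/
theorem hasDerivAt_outRay (t r s : ℝ) :
    HasDerivAt (fun σ : ℝ => (t - σ, r - σ)) ((-1 : ℝ), (-1 : ℝ)) s :=
  ((hasDerivAt_id' s).const_sub t).prodMk ((hasDerivAt_id' s).const_sub r)

/-- Chain rule: a `C¹` field along the incoming ray, `d/dσ φ(t−σ, r+σ) = Dφ(t−σ, r+σ)(−1, 1)`. -/
theorem hasDerivAt_comp_inRay (hφ : ContDiff ℝ 1 (uncurry φ)) (t r s : ℝ) :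
    HasDerivAt (fun σ => φ (t - σ) (r + σ))
      (fderiv ℝ (uncurry φ) (t - s, r + s) (-1, 1)) s := by
  have hd := ((hφ.differentiable one_ne_zero) (t - s, r + s)).hasFDerivAt
  have h := HasFDerivAt.comp_hasDerivAt (f := fun σ : ℝ => (t - σ, r + σ)) s hd
    (hasDerivAt_inRay t r s)
  exact h.congr_of_eventuallyEq (Eventually.of_forall fun σ => rfl)

/-- Chain rule: a `C¹` field along the outgoing ray, `d/dσ φ(t−σ, r−σ) = Dφ(t−σ, r−σ)(−1, −1)`. -/
theorem hasDerivAt_comp_outRay (hφ : ContDiff ℝ 1 (uncurry φ)) (t r s : ℝ) :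
    HasDerivAt (fun σ => φ (t - σ) (r - σ))
      (fderiv ℝ (uncurry φ) (t - s, r - s) (-1, -1)) s := by
  have hd := ((hφ.differentiable one_ne_zero) (t - s, r - s)).hasFDerivAt
  have h := HasFDerivAt.comp_hasDerivAt (f := fun σ : ℝ => (t - σ, r - σ)) s hd
    (hasDerivAt_outRay t r s)
  exact h.congr_of_eventuallyEq (Eventually.of_forall fun σ => rfl)

/-- **Schwarz** for the second derivative of a `C²` field: `D²φ(p)(u, v) = D²φ(p)(v, u)`. -/
theorem fderiv_fderiv_symm (hφ : ContDiff ℝ 2 (uncurry φ)) (p u v : ℝ × ℝ) :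
    fderiv ℝ (fderiv ℝ (uncurry φ)) p u v = fderiv ℝ (fderiv ℝ (uncurry φ)) p v u := by
  have hs : IsSymmSndFDerivAt ℝ (uncurry φ) p :=
    (hφ.contDiffAt (x := p)).isSymmSndFDerivAt (by simp)
  exact hs u v

/-- Dictionary: `iteratedDeriv 2` along time lines is `D²φ(p)((1,0),(1,0))`. -/
theorem iteratedDeriv_time_eq_snd (hφ : ContDiff ℝ 2 (uncurry φ)) (t r : ℝ) :
    iteratedDeriv 2 (fun s => φ s r) t
      = fderiv ℝ (fderiv ℝ (uncurry φ)) (t, r) (1, 0) (1, 0) := by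
  rw [iteratedDeriv_time_eq hφ, fderiv_fderiv_apply hφ]

/-- Dictionary: `iteratedDeriv 2` along space lines is `D²φ(p)((0,1),(0,1))`. -/
theorem iteratedDeriv_space_eq_snd (hφ : ContDiff ℝ 2 (uncurry φ)) (t r : ℝ) :
    iteratedDeriv 2 (φ t) r
      = fderiv ℝ (fderiv ℝ (uncurry φ)) (t, r) (0, 1) (0, 1) := by
  rw [iteratedDeriv_space_eq hφ, fderiv_fderiv_apply hφ]

/-- First-order algebra along the outgoing ray: `Dφ(p)(−1,−1) = −(φ_t + φ_r)`. -/
theorem fderiv_outRay_dir (p : ℝ × ℝ) :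
    fderiv ℝ (uncurry φ) p (-1, -1)
      = -(fderiv ℝ (uncurry φ) p (1, 0) + fderiv ℝ (uncurry φ) p (0, 1)) := by
  have e : ((-1 : ℝ), (-1 : ℝ)) = -(((1 : ℝ), (0 : ℝ)) + ((0 : ℝ), (1 : ℝ))) := by
    ext <;> norm_num
  rw [e, map_neg, map_add]

/-- Second-order algebra along the incoming ray (Schwarz):
`D²φ(−1,1)(1,0) + D²φ(−1,1)(0,1) = −(φ_tt − φ_rr)`. -/
theorem fderiv_fderiv_inRay_dir (hφ : ContDiff ℝ 2 (uncurry φ)) (p : ℝ × ℝ) :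
    fderiv ℝ (fderiv ℝ (uncurry φ)) p (-1, 1) (1, 0)
        + fderiv ℝ (fderiv ℝ (uncurry φ)) p (-1, 1) (0, 1)
      = -(fderiv ℝ (fderiv ℝ (uncurry φ)) p (1, 0) (1, 0)
          - fderiv ℝ (fderiv ℝ (uncurry φ)) p (0, 1) (0, 1)) := by
  have e : ((-1 : ℝ), (1 : ℝ)) = -((1 : ℝ), (0 : ℝ)) + ((0 : ℝ), (1 : ℝ)) := by
    ext <;> norm_num
  rw [e, map_add, map_neg]
  simp only [add_apply, neg_apply]
  rw [fderiv_fderiv_symm hφ p (0, 1) (1, 0)]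
  ring

/-- Second-order algebra along the outgoing ray (Schwarz):
`D²φ(−1,−1)(1,0) − D²φ(−1,−1)(0,1) = −(φ_tt − φ_rr)`. -/
theorem fderiv_fderiv_outRay_dir (hφ : ContDiff ℝ 2 (uncurry φ)) (p : ℝ × ℝ) :
    fderiv ℝ (fderiv ℝ (uncurry φ)) p (-1, -1) (1, 0)
        - fderiv ℝ (fderiv ℝ (uncurry φ)) p (-1, -1) (0, 1)
      = -(fderiv ℝ (fderiv ℝ (uncurry φ)) p (1, 0) (1, 0)
          - fderiv ℝ (fderiv ℝ (uncurry φ)) p (0, 1) (0, 1)) := by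
  have e : ((-1 : ℝ), (-1 : ℝ)) = -(((1 : ℝ), (0 : ℝ)) + ((0 : ℝ), (1 : ℝ))) := by
    ext <;> norm_num
  rw [e, map_neg, map_add]
  simp only [add_apply, neg_apply]
  rw [fderiv_fderiv_symm hφ p (0, 1) (1, 0)]
  ring

/-- Along the incoming ray, `d/dσ (φ_t + φ_r)(t−σ, r+σ) = −(φ_tt − φ_rr)(t−σ, r+σ)`. -/
theorem hasDerivAt_w_inRay (hφ : ContDiff ℝ 2 (uncurry φ)) (t r s : ℝ) :
    HasDerivAt (fun σ => fderiv ℝ (uncurry φ) (t - σ, r + σ) (1, 0)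
        + fderiv ℝ (uncurry φ) (t - σ, r + σ) (0, 1))
      (-(fderiv ℝ (fderiv ℝ (uncurry φ)) (t - s, r + s) (1, 0) (1, 0)
          - fderiv ℝ (fderiv ℝ (uncurry φ)) (t - s, r + s) (0, 1) (0, 1))) s := by
  have h1 := hasDerivAt_comp_inRay (contDiff_one_fderiv_apply hφ (1, 0)) t r s
  have h2 := hasDerivAt_comp_inRay (contDiff_one_fderiv_apply hφ (0, 1)) t r s
  rw [fderiv_fderiv_apply hφ] at h1 h2
  rw [← fderiv_fderiv_inRay_dir hφ]
  exact h1.add h2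

/-- Along the outgoing ray, `d/dσ φ(t−σ, r−σ) = −(φ_t + φ_r)(t−σ, r−σ)`. -/
theorem hasDerivAt_phi_outRay (hφ : ContDiff ℝ 1 (uncurry φ)) (t r s : ℝ) :
    HasDerivAt (fun σ => φ (t - σ) (r - σ))
      (-(fderiv ℝ (uncurry φ) (t - s, r - s) (1, 0)
          + fderiv ℝ (uncurry φ) (t - s, r - s) (0, 1))) s := by
  rw [← fderiv_outRay_dir]
  exact hasDerivAt_comp_outRay hφ t r s

/-- Along the outgoing ray, `d/dσ (φ_t − φ_r)(t−σ, r−σ) = −(φ_tt − φ_rr)(t−σ, r−σ)`. -/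
theorem hasDerivAt_z_outRay (hφ : ContDiff ℝ 2 (uncurry φ)) (t r s : ℝ) :
    HasDerivAt (fun σ => fderiv ℝ (uncurry φ) (t - σ, r - σ) (1, 0)
        - fderiv ℝ (uncurry φ) (t - σ, r - σ) (0, 1))
      (-(fderiv ℝ (fderiv ℝ (uncurry φ)) (t - s, r - s) (1, 0) (1, 0)
          - fderiv ℝ (fderiv ℝ (uncurry φ)) (t - s, r - s) (0, 1) (0, 1))) s := by
  have h1 := hasDerivAt_comp_outRay (contDiff_one_fderiv_apply hφ (1, 0)) t r s
  have h2 := hasDerivAt_comp_outRay (contDiff_one_fderiv_apply hφ (0, 1)) t r s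
  rw [fderiv_fderiv_apply hφ] at h1 h2
  rw [← fderiv_fderiv_outRay_dir hφ]
  exact h1.sub h2

/-- Continuity of the first partials `p ↦ Dφ(p) v` of a `C²` field. -/
theorem continuous_fderiv_apply' (hφ : ContDiff ℝ 2 (uncurry φ)) (v : ℝ × ℝ) :
    Continuous fun p : ℝ × ℝ => fderiv ℝ (uncurry φ) p v :=
  (hφ.continuous_fderiv (by simp)).clm_apply continuous_const

/-- Continuity of the second partials `p ↦ D²φ(p) u v` of a `C²` field. -/
theorem continuous_fderiv_fderiv_apply (hφ : ContDiff ℝ 2 (uncurry φ)) (u v : ℝ × ℝ) :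
    Continuous fun p : ℝ × ℝ => fderiv ℝ (fderiv ℝ (uncurry φ)) p u v := by
  have h1 : ContDiff ℝ 1 (fderiv ℝ (uncurry φ)) := hφ.fderiv_right (m := 1) (by norm_num)
  have h2 : Continuous (fderiv ℝ (fderiv ℝ (uncurry φ))) := h1.continuous_fderiv one_ne_zero
  exact (h2.clm_apply continuous_const).clm_apply continuous_const

/-- The incoming ray is continuous. -/
theorem continuous_inRay (t r : ℝ) : Continuous fun σ : ℝ => (t - σ, r + σ) :=
  (continuous_const.sub continuous_id).prodMk (continuous_const.add continuous_id)

/-- The outgoing ray is continuous. -/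
theorem continuous_outRay (t r : ℝ) : Continuous fun σ : ℝ => (t - σ, r - σ) :=
  (continuous_const.sub continuous_id).prodMk (continuous_const.sub continuous_id)

/-- FTC packaging: if `g' = −d` everywhere with `d` continuous, then `g 0 = g a + ∫₀ᵃ d`. -/
theorem eq_add_integral_of_hasDerivAt_neg {g d : ℝ → ℝ} (hd : Continuous d)
    (hg : ∀ s, HasDerivAt g (-d s) s) (a : ℝ) :
    g 0 = g a + ∫ s in (0 : ℝ)..a, d s := by
  have h := intervalIntegral.integral_eq_sub_of_hasDerivAt (a := 0) (b := a)
    (fun s _ => hg s) (hd.neg.intervalIntegrable 0 a)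
  rw [intervalIntegral.integral_neg] at h
  linarith

/-- **Incoming transport identity** (`fderiv` form):
`(φ_t + φ_r)(t,r) = (φ_t + φ_r)(t−a, r+a) + ∫₀ᵃ (φ_tt − φ_rr)(t−s, r+s) ds`. -/
theorem transport_inRay (hφ : ContDiff ℝ 2 (uncurry φ)) (t r a : ℝ) :
    fderiv ℝ (uncurry φ) (t, r) (1, 0) + fderiv ℝ (uncurry φ) (t, r) (0, 1)
      = (fderiv ℝ (uncurry φ) (t - a, r + a) (1, 0) + fderiv ℝ (uncurry φ) (t - a, r + a) (0, 1))
        + ∫ s in (0 : ℝ)..a, (fderiv ℝ (fderiv ℝ (uncurry φ)) (t - s, r + s) (1, 0) (1, 0)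
            - fderiv ℝ (fderiv ℝ (uncurry φ)) (t - s, r + s) (0, 1) (0, 1)) := by
  have hc : Continuous fun σ : ℝ =>
      fderiv ℝ (fderiv ℝ (uncurry φ)) (t - σ, r + σ) (1, 0) (1, 0)
        - fderiv ℝ (fderiv ℝ (uncurry φ)) (t - σ, r + σ) (0, 1) (0, 1) :=
    ((continuous_fderiv_fderiv_apply hφ (1, 0) (1, 0)).comp (continuous_inRay t r)).sub
      ((continuous_fderiv_fderiv_apply hφ (0, 1) (0, 1)).comp (continuous_inRay t r))
  have h := eq_add_integral_of_hasDerivAt_neg hc (fun s => hasDerivAt_w_inRay hφ t r s) a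
  simp only [sub_zero, add_zero] at h
  exact h

/-- **Outgoing transport identity for `φ`** (`fderiv` form):
`φ(t,r) = φ(t−a, r−a) + ∫₀ᵃ (φ_t + φ_r)(t−s, r−s) ds`. -/
theorem transport_phi_outRay (hφ : ContDiff ℝ 2 (uncurry φ)) (t r a : ℝ) :
    φ t r = φ (t - a) (r - a)
      + ∫ s in (0 : ℝ)..a, (fderiv ℝ (uncurry φ) (t - s, r - s) (1, 0)
          + fderiv ℝ (uncurry φ) (t - s, r - s) (0, 1)) := by
  have hc : Continuous fun σ : ℝ =>
      fderiv ℝ (uncurry φ) (t - σ, r - σ) (1, 0) + fderiv ℝ (uncurry φ) (t - σ, r - σ) (0, 1) :=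
    ((continuous_fderiv_apply' hφ (1, 0)).comp (continuous_outRay t r)).add
      ((continuous_fderiv_apply' hφ (0, 1)).comp (continuous_outRay t r))
  have h := eq_add_integral_of_hasDerivAt_neg hc
    (fun s => hasDerivAt_phi_outRay (hφ.of_le (by norm_num)) t r s) a
  simp only [sub_zero] at h
  exact h

/-- **Outgoing transport identity for `z = φ_t − φ_r`** (`fderiv` form):
`z(t,r) = z(t−a, r−a) + ∫₀ᵃ (φ_tt − φ_rr)(t−s, r−s) ds`. -/
theorem transport_z_outRay (hφ : ContDiff ℝ 2 (uncurry φ)) (t r a : ℝ) :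
    fderiv ℝ (uncurry φ) (t, r) (1, 0) - fderiv ℝ (uncurry φ) (t, r) (0, 1)
      = (fderiv ℝ (uncurry φ) (t - a, r - a) (1, 0) - fderiv ℝ (uncurry φ) (t - a, r - a) (0, 1))
        + ∫ s in (0 : ℝ)..a, (fderiv ℝ (fderiv ℝ (uncurry φ)) (t - s, r - s) (1, 0) (1, 0)
            - fderiv ℝ (fderiv ℝ (uncurry φ)) (t - s, r - s) (0, 1) (0, 1)) := by
  have hc : Continuous fun σ : ℝ =>
      fderiv ℝ (fderiv ℝ (uncurry φ)) (t - σ, r - σ) (1, 0) (1, 0)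
        - fderiv ℝ (fderiv ℝ (uncurry φ)) (t - σ, r - σ) (0, 1) (0, 1) :=
    ((continuous_fderiv_fderiv_apply hφ (1, 0) (1, 0)).comp (continuous_outRay t r)).sub
      ((continuous_fderiv_fderiv_apply hφ (0, 1) (0, 1)).comp (continuous_outRay t r))
  have h := eq_add_integral_of_hasDerivAt_neg hc (fun s => hasDerivAt_z_outRay hφ t r s) a
  simp only [sub_zero] at h
  exact h

/-- A function vanishing on the closed half-line `[a, ∞)` and differentiable at a point `x ≥ a`
has zero derivative at `x` (at `x = a`: uniqueness of the one-sided derivative within `Ici a`). -/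
theorem deriv_eq_zero_of_eqOn_Ici {f : ℝ → ℝ} {a x : ℝ} (hf : DifferentiableAt ℝ f x)
    (h0 : ∀ y, a ≤ y → f y = 0) (hx : a ≤ x) : deriv f x = 0 := by
  have h1 : HasDerivWithinAt f (deriv f x) (Ici x) x := hf.hasDerivAt.hasDerivWithinAt
  have h2 : HasDerivWithinAt f 0 (Ici x) x :=
    (hasDerivWithinAt_const x (Ici x) (0 : ℝ)).congr (fun y hy => h0 y (hx.trans hy)) (h0 x hx)
  exact (uniqueDiffWithinAt_Ici x).eq_deriv _ h1 h2

/-- The second derivative of a difference of `C²` fields is the difference of the second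
derivatives. -/
theorem fderiv_fderiv_sub {ψ χ : ℝ → ℝ → ℝ} (hψ : ContDiff ℝ 2 (uncurry ψ))
    (hχ : ContDiff ℝ 2 (uncurry χ)) (p : ℝ × ℝ) :
    fderiv ℝ (fderiv ℝ (uncurry fun t r => ψ t r - χ t r)) p
      = fderiv ℝ (fderiv ℝ (uncurry ψ)) p - fderiv ℝ (fderiv ℝ (uncurry χ)) p := by
  have hψ1 : ContDiff ℝ 1 (uncurry ψ) := hψ.of_le (by norm_num)
  have hχ1 : ContDiff ℝ 1 (uncurry χ) := hχ.of_le (by norm_num)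
  have h1 : fderiv ℝ (uncurry fun t r => ψ t r - χ t r)
      = fun q => fderiv ℝ (uncurry ψ) q - fderiv ℝ (uncurry χ) q := by
    funext q
    exact fderiv_fun_sub ((hψ1.differentiable one_ne_zero) q)
      ((hχ1.differentiable one_ne_zero) q)
  rw [h1]
  exact fderiv_fun_sub
    (((hψ.fderiv_right (m := 1) (by norm_num)).differentiable one_ne_zero) p)
    (((hχ.fderiv_right (m := 1) (by norm_num)).differentiable one_ne_zero) p)

end Rays

/-- The `let` form of the registered statement (the skeleton's original layout): continuity of
`φ = ψ − χ`, `w = φ_t + φ_r`, `z = φ_t − φ_r`, `D = φ_tt − φ_rr`, the three transport identities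
along the characteristics, and the slab / cylinder data facts. -/
theorem characteristicCalculus_let :
  ∀ (T R₀ : ℝ) (ψ χ : ℝ → ℝ → ℝ),
    ContDiff ℝ 2 (Function.uncurry ψ) → ContDiff ℝ 2 (Function.uncurry χ) →
    (∀ r, R₀ ≤ r → χ T r = ψ T r ∧ deriv (fun s ↦ χ s r) T = deriv (fun s ↦ ψ s r) T) →
    (∀ t, T ≤ t → χ t R₀ = ψ t R₀) →
    let φ : ℝ → ℝ → ℝ := fun t r ↦ ψ t r - χ t r
    let w : ℝ → ℝ → ℝ := fun t r ↦
      deriv (fun s ↦ ψ s r - χ s r) t + deriv (fun s ↦ ψ t s - χ t s) r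
    let z : ℝ → ℝ → ℝ := fun t r ↦
      deriv (fun s ↦ ψ s r - χ s r) t - deriv (fun s ↦ ψ t s - χ t s) r
    let D : ℝ → ℝ → ℝ := fun t r ↦
      (iteratedDeriv 2 (fun s ↦ ψ s r) t - iteratedDeriv 2 (ψ t) r) -
        (iteratedDeriv 2 (fun s ↦ χ s r) t - iteratedDeriv 2 (χ t) r)
    Continuous (Function.uncurry φ) ∧ Continuous (Function.uncurry w) ∧
      Continuous (Function.uncurry z) ∧ Continuous (Function.uncurry D) ∧
    (∀ t r a : ℝ, w t r = w (t - a) (r + a) + ∫ s in (0 : ℝ)..a, D (t - s) (r + s)) ∧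
    (∀ t r a : ℝ, φ t r = φ (t - a) (r - a) + ∫ s in (0 : ℝ)..a, w (t - s) (r - s)) ∧
    (∀ t r a : ℝ, z t r = z (t - a) (r - a) + ∫ s in (0 : ℝ)..a, D (t - s) (r - s)) ∧
    (∀ r, R₀ ≤ r → φ T r = 0 ∧ w T r = 0 ∧ z T r = 0) ∧
    (∀ t, T ≤ t → φ t R₀ = 0 ∧ z t R₀ = -w t R₀) := by
  intro T R₀ ψ χ hψ hχ hslab hcyl φ w z D
  have hφ : ContDiff ℝ 2 (uncurry φ) := hψ.sub hχ
  have hφ1 : ContDiff ℝ 1 (uncurry φ) := hφ.of_le (by norm_num)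
  have hψ1 : ContDiff ℝ 1 (uncurry ψ) := hψ.of_le (by norm_num)
  have hχ1 : ContDiff ℝ 1 (uncurry χ) := hχ.of_le (by norm_num)
  -- the dictionary: `w`, `z`, `D` in `fderiv` form
  have hw : w = fun t r =>
      fderiv ℝ (uncurry φ) (t, r) (1, 0) + fderiv ℝ (uncurry φ) (t, r) (0, 1) := by
    funext t r
    show deriv (fun s => φ s r) t + deriv (φ t) r = _
    rw [deriv_time_eq hφ1, deriv_space_eq hφ1]
  have hz : z = fun t r =>
      fderiv ℝ (uncurry φ) (t, r) (1, 0) - fderiv ℝ (uncurry φ) (t, r) (0, 1) := by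
    funext t r
    show deriv (fun s => φ s r) t - deriv (φ t) r = _
    rw [deriv_time_eq hφ1, deriv_space_eq hφ1]
  have hD : D = fun t r =>
      fderiv ℝ (fderiv ℝ (uncurry φ)) (t, r) (1, 0) (1, 0)
        - fderiv ℝ (fderiv ℝ (uncurry φ)) (t, r) (0, 1) (0, 1) := by
    funext t r
    have e : fderiv ℝ (fderiv ℝ (uncurry φ)) (t, r)
        = fderiv ℝ (fderiv ℝ (uncurry ψ)) (t, r) - fderiv ℝ (fderiv ℝ (uncurry χ)) (t, r) :=
      fderiv_fderiv_sub hψ hχ (t, r)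
    show (iteratedDeriv 2 (fun s => ψ s r) t - iteratedDeriv 2 (ψ t) r) -
        (iteratedDeriv 2 (fun s => χ s r) t - iteratedDeriv 2 (χ t) r) = _
    rw [iteratedDeriv_time_eq_snd hψ, iteratedDeriv_space_eq_snd hψ,
      iteratedDeriv_time_eq_snd hχ, iteratedDeriv_space_eq_snd hχ, e]
    simp only [sub_apply]
    ring
  -- the data facts for `φ`
  have hφT : ∀ r, R₀ ≤ r → φ T r = 0 := fun r hr => by
    show ψ T r - χ T r = 0
    rw [(hslab r hr).1, sub_self]
  have hφR : ∀ t, T ≤ t → φ t R₀ = 0 := fun t ht => by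
    show ψ t R₀ - χ t R₀ = 0
    rw [hcyl t ht, sub_self]
  have hφtT : ∀ r, R₀ ≤ r → fderiv ℝ (uncurry φ) (T, r) (1, 0) = 0 := fun r hr => by
    rw [← deriv_time_eq hφ1]
    show deriv (fun s => ψ s r - χ s r) T = 0
    rw [deriv_fun_sub (hasDerivAt_time hψ1 T r).differentiableAt
      (hasDerivAt_time hχ1 T r).differentiableAt, (hslab r hr).2, sub_self]
  have hφrT : ∀ r, R₀ ≤ r → fderiv ℝ (uncurry φ) (T, r) (0, 1) = 0 := fun r hr => by
    rw [← deriv_space_eq hφ1]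
    exact deriv_eq_zero_of_eqOn_Ici (hasDerivAt_space hφ1 T r).differentiableAt hφT hr
  have hφtR : ∀ t, T ≤ t → fderiv ℝ (uncurry φ) (t, R₀) (1, 0) = 0 := fun t ht => by
    rw [← deriv_time_eq hφ1]
    exact deriv_eq_zero_of_eqOn_Ici (hasDerivAt_time hφ1 t R₀).differentiableAt hφR ht
  refine ⟨hφ.continuous, ?_, ?_, ?_, ?_, ?_, ?_, ?_, ?_⟩
  · rw [hw]
    exact (continuous_fderiv_apply' hφ (1, 0)).add (continuous_fderiv_apply' hφ (0, 1))
  · rw [hz]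
    exact (continuous_fderiv_apply' hφ (1, 0)).sub (continuous_fderiv_apply' hφ (0, 1))
  · rw [hD]
    exact (continuous_fderiv_fderiv_apply hφ (1, 0) (1, 0)).sub
      (continuous_fderiv_fderiv_apply hφ (0, 1) (0, 1))
  · intro t r a
    rw [hw, hD]
    exact transport_inRay hφ t r a
  · intro t r a
    rw [hw]
    exact transport_phi_outRay hφ t r a
  · intro t r a
    rw [hz, hD]
    exact transport_z_outRay hφ t r a
  · intro r hr
    refine ⟨hφT r hr, ?_, ?_⟩
    · rw [hw]
      show fderiv ℝ (uncurry φ) (T, r) (1, 0) + fderiv ℝ (uncurry φ) (T, r) (0, 1) = 0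
      rw [hφtT r hr, hφrT r hr, add_zero]
    · rw [hz]
      show fderiv ℝ (uncurry φ) (T, r) (1, 0) - fderiv ℝ (uncurry φ) (T, r) (0, 1) = 0
      rw [hφtT r hr, hφrT r hr, sub_zero]
  · intro t ht
    refine ⟨hφR t ht, ?_⟩
    rw [hz, hw]
    show fderiv ℝ (uncurry φ) (t, R₀) (1, 0) - fderiv ℝ (uncurry φ) (t, R₀) (0, 1)
      = -(fderiv ℝ (uncurry φ) (t, R₀) (1, 0) + fderiv ℝ (uncurry φ) (t, R₀) (0, 1))
    rw [hφtR t ht]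
    ring

/-- Registered stub R2 of line `bargmann-small-late-exterior` (statement `CharacteristicCalculus`):
for `C²` fields `ψ, χ` with matching slab data on `{t = T, r ≥ R₀}` and matching trace on
`{r = R₀, t ≥ T}`, and `φ, w, z, D` given pointwise by `φ = ψ − χ`, `w = φ_t + φ_r`,
`z = φ_t − φ_r`, `D = φ_tt − φ_rr` (slice `deriv` / `iteratedDeriv 2` form): continuity of the
four fields, the three transport identities along the characteristics, and the slab / cylinder
data facts.  (`let`-free form: the defining equations are hypotheses, discharged by
`fun _ _ ↦ rfl`.) -/
theorem stub_characteristicCalculus :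
  ∀ (T R₀ : ℝ) (ψ χ φ w z D : ℝ → ℝ → ℝ),
    ContDiff ℝ 2 (Function.uncurry ψ) → ContDiff ℝ 2 (Function.uncurry χ) →
    (∀ r, R₀ ≤ r → χ T r = ψ T r ∧ deriv (fun s ↦ χ s r) T = deriv (fun s ↦ ψ s r) T) →
    (∀ t, T ≤ t → χ t R₀ = ψ t R₀) →
    (∀ t r, φ t r = ψ t r - χ t r) →
    (∀ t r, w t r = deriv (fun s ↦ ψ s r - χ s r) t + deriv (fun s ↦ ψ t s - χ t s) r) →
    (∀ t r, z t r = deriv (fun s ↦ ψ s r - χ s r) t - deriv (fun s ↦ ψ t s - χ t s) r) →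
    (∀ t r, D t r = (iteratedDeriv 2 (fun s ↦ ψ s r) t - iteratedDeriv 2 (ψ t) r) -
        (iteratedDeriv 2 (fun s ↦ χ s r) t - iteratedDeriv 2 (χ t) r)) →
    Continuous (Function.uncurry φ) ∧ Continuous (Function.uncurry w) ∧
      Continuous (Function.uncurry z) ∧ Continuous (Function.uncurry D) ∧
    (∀ t r a : ℝ, w t r = w (t - a) (r + a) + ∫ s in (0 : ℝ)..a, D (t - s) (r + s)) ∧
    (∀ t r a : ℝ, φ t r = φ (t - a) (r - a) + ∫ s in (0 : ℝ)..a, w (t - s) (r - s)) ∧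
    (∀ t r a : ℝ, z t r = z (t - a) (r - a) + ∫ s in (0 : ℝ)..a, D (t - s) (r - s)) ∧
    (∀ r, R₀ ≤ r → φ T r = 0 ∧ w T r = 0 ∧ z T r = 0) ∧
    (∀ t, T ≤ t → φ t R₀ = 0 ∧ z t R₀ = -w t R₀) := by
  intro T R₀ ψ χ φ w z D hψ hχ hslab hcyl hφ hw hz hD
  obtain rfl : φ = _ := funext fun t ↦ funext fun r ↦ hφ t r
  obtain rfl : w = _ := funext fun t ↦ funext fun r ↦ hw t r
  obtain rfl : z = _ := funext fun t ↦ funext fun r ↦ hz t r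
  obtain rfl : D = _ := funext fun t ↦ funext fun r ↦ hD t r
  exact characteristicCalculus_let T R₀ ψ χ hψ hχ hslab hcyl

end Summit.FinalStateConjecture.FinalStateConjecture.Theorems.NecksCertifyBargmann.Calculus

end
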